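import Summits.AtomisticToContinuum.HydrodynamicLimit.Theorems.RelayRaceLocalityNearConstantShortTimeHLMeansPin
import Summits.AtomisticToContinuum.HydrodynamicLimit.Theorems.RelayRaceLocalityNearConstantShortTimeHLMeansNecessary
import Summits.AtomisticToContinuum.HydrodynamicLimit.Theorems.RelayRaceLocalityNearConstantShortTimeHLMeansPinDockNC
import HarnessLib

/-!
# Crux `NearConstantShortTimeHL` (stmt-AtomisticToContinuum-12502), line `means-pin-entropy` — the dock is an equivalence

With the pin (`stub_meansPin`), the engine bridge (`oneMeanLowerBound_of_meansConverge`), the entropy step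
(`stub_entropyToLLN`) and the converse (`meansConverge_of_nearConstantShortTimeHL`) all landed, the line's reduction is
one theorem: modulo the two general-family STATICS stubs (`GeneralFamilyLDA`, `GeneralFamilyConcentration`) the crux
`NearConstantShortTimeHL` is EQUIVALENT to convergence of the means `MeansConverge` (either currency), and the engine slot
`OneMeanLowerBound` sits between them. No new mathematics here — composition only.
-/

noncomputable section

namespace Summit.AtomisticToContinuum.HydrodynamicLimit.Theorems.NearConstantShortTimeHL

open Summit.AtomisticToContinuum.HydrodynamicLimit.Theses.RelayRaceLocality (NearConstantShortTimeHL)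

/-- **Means ⇒ Yau-form target, modulo statics** (the small-tilt line's dock `stub_meansToRelEntropy` and the
tilt-radius line's `stub_meansPin`, now corollaries of this line): `GeneralFamilyLDA → GeneralFamilyConcentration →
MeansConverge → NearConstantRelEntropy`. [cite: Yau1991, §2] -/
theorem nearConstantRelEntropy_of_meansConverge :
    GeneralFamilyLDA → GeneralFamilyConcentration → MeansConverge → NearConstantRelEntropy :=
  fun h₁ h₂ h => stub_meansPin h₁ h₂ (oneMeanLowerBound_of_meansConverge h)

/-- **The crux is equivalent to convergence of the means, modulo the two statics stubs.** [cite: Yau1991, §2] -/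
theorem nearConstantShortTimeHL_iff_meansConverge :
    GeneralFamilyLDA → GeneralFamilyConcentration → (NearConstantShortTimeHL ↔ MeansConverge) :=
  fun h₁ h₂ => ⟨meansConverge_of_nearConstantShortTimeHL,
    fun h => stub_entropyToLLN (nearConstantRelEntropy_of_meansConverge h₁ h₂ h)⟩

/-- **… and to the second engine's currency.** [cite: Yau1991, §2] -/
theorem nearConstantShortTimeHL_iff_meansConvergeNC :
    GeneralFamilyLDA → GeneralFamilyConcentration → (NearConstantShortTimeHL ↔ MeansConvergeNC) :=
  fun h₁ h₂ => ⟨fun h => meansConvergeNC_of_meansConverge (meansConverge_of_nearConstantShortTimeHL h),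
    fun h => (nearConstantShortTimeHL_iff_meansConverge h₁ h₂).2 (meansConverge_of_meansConvergeNC h)⟩

/-- **The engine slot is crux-strength, modulo statics**: `OneMeanLowerBound` follows from the crux (no statics needed)
and implies it given the two statics stubs. [cite: Yau1991, §2] -/
theorem nearConstantShortTimeHL_iff_oneMeanLowerBound :
    GeneralFamilyLDA → GeneralFamilyConcentration → (NearConstantShortTimeHL ↔ OneMeanLowerBound) :=
  fun h₁ h₂ => ⟨fun h => oneMeanLowerBound_of_meansConverge (meansConverge_of_nearConstantShortTimeHL h),
    fun h => stub_entropyToLLN (stub_meansPin h₁ h₂ h)⟩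

end Summit.AtomisticToContinuum.HydrodynamicLimit.Theorems.NearConstantShortTimeHL

end
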